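import Summits.PneNP.PneNP.Theses.RootDecompSpaceCeiling
import Literature.Computability.Complexity.Counting
import Literature.Computability.Complexity.CountingProofs
import Literature.Computability.Complexity.OracleEmptyFP
import Literature.Computability.Complexity.BrickAlgebra

/-! # Root decomposition N3 (SpaceCeiling) — the two ends of the census-description dial

Closes the aside item stmt-PneNP-32374 `CensusDialEnds` of route `route-PneNP-RootDecompSpaceCeiling`
(cycle-2 node of the decomp-pnenp cell; writer g6 rev 7): (i) the TOP cell `b(m) = m + O(1)` is
decided absolutely — a census of `m`-bit witnesses is `≤ 2^m`, so its binary expansion is an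
`(m+1)`-bit advice decoded by the second projection `Brick.sndF ∈ FP`; (ii) the BOTTOM: modulo the
Cai–Hemachandra binder (typed in the item as an explicit hypothesis) the guarded log cell is
`≡ K_Fn «NP ⊆ P → #P ⊆ FP»`.

Port of lens-3 g10 `censusDesc_top` + `collapseLiftFn_iff_censusLift` at `b = log` / writer
certificate `N3C2_items-g6.lean` (`censusDialEnds_holds`). Hypothesis-free; standard axioms only.
-/

namespace Summit.PneNP.PneNP.Theorems

open Literature.Computability.Complexity

/-- DIAL ENDS of the census-description dial on `K = CollapseLift` (stmt-PneNP-23703): the TOP cell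
`b(m) = m + O(1)` holds absolutely (advice = the census in binary, decoder = `Brick.sndF`), and modulo
the Cai–Hemachandra binder (explicit hypothesis) the guarded `O(log m)` cell is equivalent to `K_Fn`
(under `#P ⊆ FP` the decoder computes the census itself with empty advice). Closes stmt-PneNP-32374. -/
theorem censusDialEnds_proof :
    Summit.PneNP.PneNP.Theses.RootDecompSpaceCeiling.CensusDialEnds := by
  unfold Summit.PneNP.PneNP.Theses.RootDecompSpaceCeiling.CensusDialEnds
  -- FLOOR ⟹ every census cell with EMPTY advice (budget function `b` arbitrary)
  have hCell : ∀ b : ℕ → ℕ, (∀ f ∈ SharpP, (Computability.encodeNat ∘ f) ∈ FP) →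
      ∀ R ∈ Classes.P, ∀ p : Polynomial ℕ, ∃ D ∈ FP, ∃ c : ℕ, ∀ x : List Bool, ∃ i : List Bool,
        i.length ≤ c * b (p.eval x.length) + c ∧
        D (boolPair x i) = Computability.encodeNat (countWitnesses R (p.eval x.length) x) := by
    intro b h R hR p
    have hfS : (fun x => countWitnesses R (p.eval x.length) x) ∈ SharpP := ⟨R, hR, p, fun _ => rfl⟩
    refine ⟨(Computability.encodeNat ∘ fun x => countWitnesses R (p.eval x.length) x) ∘ Brick.fstF,
      comp_mem_FP (h _ hfS) Brick.fstF_mem_FP, 0, fun x => ⟨[], by simp, ?_⟩⟩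
    simp [Brick.fstF_boolPair]
  -- TOP CELL decided: advice = the census in binary, decoder = `Brick.sndF`
  have hTop : ∀ R ∈ Classes.P, ∀ p : Polynomial ℕ, ∃ D ∈ FP, ∃ c : ℕ, ∀ x : List Bool,
      ∃ i : List Bool, i.length ≤ c * (p.eval x.length) + c ∧
        D (boolPair x i) = Computability.encodeNat (countWitnesses R (p.eval x.length) x) := by
    intro R hR p
    refine ⟨Brick.sndF, Brick.sndF_mem_FP, 1, fun x => ?_⟩
    refine ⟨Computability.encodeNat (countWitnesses R (p.eval x.length) x), ?_,
      by simp [Brick.sndF_boolPair]⟩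
    -- a census of `m`-bit witnesses never exceeds `2^m`
    have hle : countWitnesses R (p.eval x.length) x ≤ 2 ^ (p.eval x.length) := by
      classical
      unfold countWitnesses
      refine le_trans (Finset.card_filter_le _ _) ?_
      simp [Finset.card_univ, card_vector]
    have hlt : countWitnesses R (p.eval x.length) x < 2 ^ (p.eval x.length + 1) :=
      lt_of_le_of_lt hle (Nat.pow_lt_pow_right (by norm_num) (by omega))
    -- `|bin v| ≤ k` when `v < 2^k`
    have hlen : (Computability.encodeNat (countWitnesses R (p.eval x.length) x)).length ≤
        p.eval x.length + 1 := by
      rw [TM2Pass.length_encodeNat_eq_size]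
      exact Nat.size_le.2 hlt
    omega
  refine ⟨hTop, fun hCH => ⟨fun hL hNP => hCH (hL hNP), fun hK hNP => ?_⟩⟩
  exact hCell (fun m => Nat.log2 m) (hK hNP)

end Summit.PneNP.PneNP.Theorems
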